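import Literature.MathematicalPhysics.QuantumFieldTheory.Balaban1983to89.B9Thm34SectBFinal
import Literature.MathematicalPhysics.QuantumFieldTheory.Balaban1983to89.B9Thm34RFinal

/-!
# `Balaban1983to89.B9Thm34AllFinal` — [Balaban1985BackgroundPropagators] THEOREM 3.4 p. 400 FOR ALL FOUR OPERATORS IT NAMES — `G′(U′U)`,
# `(Q′G′²Q′*)⁻¹(U′U)`, `R(U′U)` (through `P = I − R`), `G(U′U)` — UNDER ONE `∃ α₁ > 0 ∃ B ∀ A` AND WITH ONE `C⁻¹(U′U)`: the conjunction of
# FILE 26 `thm34_sectB_final` and FILE 27 `thm34_R_final` (FILE 28 of the Sect. B programme of cell `lit-balaban`, seat r06 gen 14)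

statement-level skeleton of published theorems with citation tags; proofs where landed; nothing here is a claim about the Yang–Mills mass gap

CITATION HEADER (lean-in-tree rule).  B9 = T. Bałaban, *Propagators for lattice gauge theories in a background field*, Commun. Math. Phys. **99** (1985)
389–434 (journal page = PDF page + 388).  Theorem 3.4 p. 400 [PDF 12] «There exists a positive constant a₁ such that the operators G′(U), (Q′(U)G′²(U)Q′*(U))⁻¹, R(U), G(U) extend to configurations U′U for
α₁ ≦ a₁ as analytic functions of A. The extended operators satisfy all the inequalities of Theorems 3.1–3.3 correspondingly»
(verbatim p. 400 [PDF 12] L7–10; «for α₁ sufficiently small» is pp. 401–403, «of course with different constants» is p. 403 [PDF 15] L5 —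
docfix r06 g14 for S-B9-g38-2 / S-B9-g42-1 / CITELOC18: the earlier guillemet text here was a paraphrase, not the print); Sect. B pp. 400–407: (3.62)–(3.65) p. 402 (`G′(U′U)`), (3.65)–(3.67) p. 403 («The inverse satisfies Theorem 3.2»), (3.68) p. 403
(«the operator P(U′U) satisfies the bounds (3.49). Moreover we have P(U′U) = P(U) + P′(A), …»), (3.84)–(3.86) p. 407 (`G(U′U)`), p. 407 «Thus
Theorem 3.4 is proved, assuming that Theorems 3.1–3.3 hold»; Thm 3.1 (3.42) p. 397; Thm 3.2 (3.48) p. 398; (3.49) p. 399; Thm 3.3 p. 399; (3.37)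
p. 396.  [4] = [Balaban1984PropagatorsII] Lemma 2.1 p. 234, (2.51)–(2.55) p. 232, (2.66) p. 234; [B11] = [Balaban1985Variational] (135) p. 298.
Rows B9.Thm3.4 × B9.Eq3.62 × B9.Eq3.66 × B9.Eq3.68 × B9.Eq3.85 (cells only; no row head changes).

WHAT IS PROVED (0 `def`, 0 sorry, 0 new named facts).
* **`thm34_all_final`** — SIGNATURE = FILE 26's `thm34_sectB_final` VERBATIM (FILE 24/25's hypotheses: Theorems 3.1/3.2/3.3 FOR `U` at `δ₀` in
  block-majorant form and, for (3.48) and Theorem 3.3's (3.42), in kernel form; [4] Lemma 2.1 and the p. 398 scale transfer for every exponent;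
  the (3.15)/(3.19)/(3.24) letters incl. `Δ′_a(U)`; (3.35); stencil geometry; the `A`-free (3.60) data); CONCLUSION `∃ a₁ > 0 ∃ B ≧ 0 ∀ α₁ ≦ a₁
  ∀ A` in (3.37) (blockwise) `∀ kF sF ∀` (3.57)/(3.59)/(3.80)–(3.81) letters: (i) `G′(U′U) := gPrimeExtEnd G′ (V′G′)` ((3.64)) is the two-sided
  inverse of `Δ′_a(U) − V′(A)` and every left/right (3.42)-entry of Theorem 3.1 transfers to it at `(B, 9δ₀/10)`; `∃ C⁻¹(U′U), G(U′U)`: (ii)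
  `C⁻¹(U′U)` is the two-sided inverse of `Q′(U′U)G′²(U′U)Q′*(U′U)` on 𝔅 with `|C⁻¹(U′U)(y,y′)| ≦ B(Lʲη)⁻⁴(L^{j′}η)^{−d}e^{−(9δ₀/25)d(y,y′)}` ((3.48));
  (ii′) **(3.68) for `P′(A)`** (four entries at `(Bα₁, δ₀/4)`) **and (3.49) for `P(U′U) = G′(U′U)Q′*(U′U)C⁻¹(U′U)Q′(U′U)G′(U′U)`** (four entries at
  `(B, δ₀/4)`) — the `R(U)`-clause, both built with THIS `C⁻¹(U′U)`; (iii) `G(U′U)` is the two-sided inverse of the concrete `Δ_a(U′U)` (whose `P′(A)`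
  carries THIS `C⁻¹(U′U)`), every left/right (3.42)-entry of Theorem 3.3 transfers at `(B, δ₀/6)`, and all four (3.42)-entries of `G(U′U)` hold in
  the printed kernel form at `(B, δ₀/10)` — ONE `a₁`, ONE `B`, ONE `C⁻¹(U′U)`.
  PROOF: FILE 26's assembly verbatim (`thm34_Gp_final`, `thm34_Cinv_final`, FILE 25 `thm34_G_kernel_final`) plus FILE 27 `thm34_R_final`; the three
  `C⁻¹(U′U)` so obtained agree by uniqueness of the two-sided inverse (Mathlib `left_inv_eq_right_inv`); constants merged by monotonicity.

HONEST SCOPE / NOT CLAIMED.  Exactly as FILES 20/24/25/26/27: Theorems 3.1–3.3 FOR `U` are inputs («assuming that Theorems 3.1–3.3 hold», p. 407);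
(3.37) blockwise in the shapes of FILES 1–19; (3.43)–(3.47) Hölder / L² / global members for `U′U` not covered (G-B9-02; hence the abstract leaf
`B9.SectBStepPrinted` is NOT instantiated by this file); (3.49)/(3.68) in block-majorant form with `D = ∇_U`; `a₁`, `B` packaged existentially
after the lattice is fixed; the rates `9δ₀/10, 9δ₀/25, δ₀/4, δ₀/6, δ₀/10` are ONE admissible choice («of course with different constants», p. 403); no row head changes.

RELATED IN THE TREE, NOT DUPLICATED (searched 2026-08-22: `lean search 'thm34_all_final|all_final' --decl` = ∅ in this block): FILE 26
`thm34_Gp_final`/`thm34_Cinv_final` (and its assembly pattern `thm34_sectB_final`), FILE 25 `thm34_G_kernel_final`, FILE 27 `thm34_R_final` USED BY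
NAME (generator `lit-balaban-r06/lean/gen28.py`, line-range extraction from the tree FILE 26).
-/

noncomputable section

namespace Literature.MathematicalPhysics.QuantumFieldTheory.Balaban1983to89.B9Thm34AllFinal

open NormedSpace Complex
open Literature.MathematicalPhysics.QuantumFieldTheory.Balaban1983to89
open Literature.MathematicalPhysics.QuantumFieldTheory.Balaban1983to89.B6RandomWalk (HasMajorant hasMajorant_mono Triangle254 Ineq261)
open Literature.MathematicalPhysics.QuantumFieldTheory.Balaban1983to89.B6RandomWalkHom (HasMajorantHom hasMajorantHom_mono hasMajorantHom_iff
  hasMajorantHom_zero)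
open Literature.MathematicalPhysics.QuantumFieldTheory.Balaban1983to89.B6RandomWalkKernel (HasKernelBound hasKernelBound_mono)
open Literature.MathematicalPhysics.QuantumFieldTheory.Balaban1983to89.B9Thm34Ext (toB6)
open Literature.MathematicalPhysics.QuantumFieldTheory.Balaban1983to89.B9Ineq347 (ScaleTransfer)
open Literature.MathematicalPhysics.QuantumFieldTheory.Balaban1983to89.B9Ineq366CPrime (hasMajorant_rate_mono kappa366 kappa366_nonneg kappa366_pos)
open Literature.MathematicalPhysics.QuantumFieldTheory.Balaban1983to89.B9Eq386Neumann (pTwo deltaA)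
open Literature.MathematicalPhysics.QuantumFieldTheory.Balaban1983to89.B9Ineq385VG (kappa385 kappa385_nonneg)
open Literature.MathematicalPhysics.QuantumFieldTheory.Balaban1983to89.B9Eq39Adjoint
open Literature.MathematicalPhysics.QuantumFieldTheory.Balaban1983to89.B9Eq369Small (Through)
open Literature.MathematicalPhysics.QuantumFieldTheory.Balaban1983to89.B9Eq372Locality (stBonds)
open Literature.MathematicalPhysics.QuantumFieldTheory.Balaban1983to89.B9Eq352DivForm (tauF tauB)
open Literature.MathematicalPhysics.QuantumFieldTheory.Balaban1983to89.B9Eq352DivFormLetters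
open Literature.MathematicalPhysics.QuantumFieldTheory.Balaban1983to89.B9Eq352GradLetters (diffLetter)
open Literature.MathematicalPhysics.QuantumFieldTheory.Balaban1983to89.B9Eq371GradLetters (bT bU)
open Literature.MathematicalPhysics.QuantumFieldTheory.Balaban1983to89.B9Eq372RemLetters (lapDDLetter)
open Literature.MathematicalPhysics.QuantumFieldTheory.Balaban1983to89.B9Eq382V3Letters (dPrimeLetter)
open Literature.MathematicalPhysics.QuantumFieldTheory.Balaban1983to89.B9Eq376POneLetters (conjHom gradLin divLin)
open Literature.MathematicalPhysics.QuantumFieldTheory.Balaban1983to89.B9Ineq385V3Concrete (cV385 cV385_nonneg)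
open Literature.MathematicalPhysics.QuantumFieldTheory.Balaban1983to89.B9Eq360Vprime (gPrimeExtEnd)
open Literature.MathematicalPhysics.QuantumFieldTheory.Balaban1983to89.B9Eq360VprimeLetters (vPrimeConc cBConc cCConc)
open Literature.MathematicalPhysics.QuantumFieldTheory.Balaban1983to89.B9Ineq363Vprime (cVConc cVConc_nonneg theta363 thetaL363 theta363_nonneg
  thetaL363_nonneg thm34_Gp_entries13_vPrime gpExt_leftEntry_vPrime gpExt_rightEntry_vPrime)
open Literature.MathematicalPhysics.QuantumFieldTheory.Balaban1983to89.B6RandomWalkSection (secExt secRes secConj)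
open Literature.MathematicalPhysics.QuantumFieldTheory.Balaban1983to89.B9Ineq366Vprime (inverse_satisfies_thm32_vPrime)
open Literature.MathematicalPhysics.QuantumFieldTheory.Balaban1983to89.B9Thm34GFinal (ineq261_rescale scaleTransfer_rescale c1_pos_of_ineq261
  exists_threshold_of_continuousAt neumann_le_two)
open Literature.MathematicalPhysics.QuantumFieldTheory.Balaban1983to89.B9Thm34GKernelFinal (thm34_G_kernel_final)
open Literature.MathematicalPhysics.QuantumFieldTheory.Balaban1983to89.B9Thm34SectBFinal (thm34_Gp_final thm34_Cinv_final
  thm34_sectB_final)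
open Literature.MathematicalPhysics.QuantumFieldTheory.Balaban1983to89.B9Thm34RFinal (thm34_R_final)

/-! ## Theorem 3.4 for the four operators together -/

section All

variable {𝔸 : Type*} [NormedRing 𝔸] [NormedAlgebra ℂ 𝔸] [CompleteSpace 𝔸] {ι : Type} [Fintype ι]
variable (b : Module.Basis ι ℝ 𝔸) {S : Type} {κ : Type} [Fintype κ] [LinearOrder κ]
variable (T : κ → Equiv.Perm S) (U : κ → S → 𝔸ˣ)
variable {g : B9.Geometry} [Fintype g.Site] {Rr : ℝ} {H : Prop}

set_option maxHeartbeats 1600000 in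
/-- **THEOREM 3.4 FOR ALL FOUR OPERATORS NAMED IN IT — `G′(U′U)`, `(Q′G′²Q′*)⁻¹(U′U)`, `R(U′U)` (via `P = I − R`), `G(U′U)` — CONCRETE PERTURBATION,
PRINTED QUANTIFIERS, ONE `C⁻¹(U′U)`** («There exists a positive constant a₁ such that the operators G′(U), (Q′(U)G′²(U)Q′*(U))⁻¹, R(U), G(U) extend to configurations U′U for
α₁ ≦ a₁ as analytic functions of A. The extended operators satisfy all the inequalities of Theorems 3.1–3.3 correspondingly», p. 400; «of course with different constants», p. 403; «Thus
Theorem 3.4 is proved, assuming that Theorems 3.1–3.3 hold», p. 407), for the sup/kernel members: hypotheses = FILE 26's `thm34_sectB_final`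
VERBATIM; conclusion = `thm34_sectB_final`'s (i) `G′(U′U)` two-sided inverse of `Δ′_a(U) − V′(A)` + left/right (3.42)-entry transfer at `(B, 9δ₀/10)`,
(ii) `C⁻¹(U′U)` two-sided inverse with the printed (3.48) kernel bound at `(B, 9δ₀/25)`, (iii) `G(U′U)` two-sided inverse of the concrete `Δ_a(U′U)`,
left/right transfer at `(B, δ₀/6)`, the four (3.42) kernel entries at `(B, δ₀/10)` — WITH, between (ii) and (iii), FILE 27's `thm34_R_final` clause
(ii′) for the SAME `C⁻¹(U′U)`: (3.68) `P′(A) ≺ Bα₁e^{−(δ₀/4)d}`, `D·P′(A), P′(A)·D* ≺ Bα₁(Lʲη)⁻¹e^{−(δ₀/4)d}`, `D·P′(A)·D* ≺ Bα₁(Lʲη)⁻²e^{−(δ₀/4)d}` and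
(3.49) for `P(U′U) = G′(U′U)Q′*(U′U)C⁻¹(U′U)Q′(U′U)G′(U′U)` (`pOp`): `P(U′U) ≺ Be^{−(δ₀/4)d}`, `D·P(U′U), P(U′U)·D* ≺ B(Lʲη)⁻¹e^{−(δ₀/4)d}`,
`D·P(U′U)·D* ≺ B(Lʲη)⁻²e^{−(δ₀/4)d}` (`D = conjHom b (gradLin T η⁻¹ U) = ∇_U`, `D* = conjHom b (divLin T η⁻¹ U)`). ONE `a₁`, ONE `B`, ONE `C⁻¹(U′U)`.
PROOF: FILE 26's assembly (`thm34_Gp_final`, `thm34_Cinv_final`, `thm34_G_kernel_final`) + `thm34_R_final`, `a₁ = min`, `B = sum`, Mathlib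
`left_inv_eq_right_inv` (the three `C⁻¹(U′U)` agree), monotonicity; `thm34_sectB_final` itself is the same assembly without (ii′).
[cite: Balaban1985BackgroundPropagators, Thm 3.4 p.400 + Sect. B (3.62)–(3.68) pp.402–403 + (3.84)–(3.86) p.407 + Thm 3.1 (3.42) p.397 + Thm 3.2 (3.48) p.398 + (3.49) p.399 + Thm 3.3 p.399 + (3.37) p.396; Balaban1984PropagatorsII, Lemma 2.1 p.234 + (2.51)–(2.55) p.232 + (2.66) p.234; Balaban1985Variational, (135) p.298] -/
theorem thm34_all_final [Fintype S] [DecidableEq S] [DecidableEq ι] [DecidableEq g.Site] [Nonempty g.Site] (blk : S → g.Site) (d : ℕ)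
    (δ₀ B₀ κQ BG B₁ cF Cq a₀ C₀ d₀ M₂ κQb cFb abar : ℝ)
    (kQ : g.Site → S → 𝔸 →L[ℝ] 𝔸) (sQ : S → 𝔸 →L[ℝ] 𝔸) (cfun w : g.Site → ℝ)
    (hB₀ : 0 ≤ B₀) (hκQ : 0 < κQ) (hBG : 0 < BG) (hB₁ : 0 < B₁) (hcF : 0 < cF) (hCq : 0 ≤ Cq) (ha₀ : 0 ≤ a₀) (hC₀ : 0 ≤ C₀)
    (hM₂ : 0 ≤ M₂) (hδ₀ : 0 < δ₀) (hκQb : 0 ≤ κQb) (hcFb : 0 ≤ cFb) (habar : 0 ≤ abar)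
    -- the multiscale geometry 𝔅 (p. 393, [4] (2.1)–(2.4)) and its axioms
    (hdnn : ∀ a a' : g.Site, 0 ≤ g.dist a a') (htri : Triangle254 (toB6 g Rr H)) (hrefl : ∀ y : g.Site, g.dist y y = 0)
    (hsym : ∀ y y' : g.Site, g.dist y y' = g.dist y' y) (hlen : ∀ y : g.Site, 0 < g.len y) (hlenη : ∀ y : g.Site, g.eta ≤ g.len y)
    (hη : 0 < g.eta) (hL : 1 ≤ g.L)
    -- [4] Lemma 2.1 (2.61) at the rate `δ₀`, «for every 0 < α < 1»
    (h261 : ∀ α : ℝ, 0 < α → α < 1 → Ineq261 d (toB6 g Rr H) δ₀ α)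
    -- p. 398: «Using Lemma 2.1 in [4] we may replace the factor (Lʲη)^α by (Lʲη)^β(L^{j′}η)^γ with β + γ = α» — for every exponent, one
    -- constant `Λ(α) ≧ 1` for the six weights `(Lʲη)^{1,2,−1,−2,−4}` (natural and real powers)
    (hST : ∀ α : ℝ, 0 < α → ∃ Λ : ℝ, 1 ≤ Λ ∧ ScaleTransfer g δ₀ α Λ (fun a => g.len a) ∧ ScaleTransfer g δ₀ α Λ (fun a => g.len a ^ 2) ∧
      ScaleTransfer g δ₀ α Λ (fun a => (g.len a)⁻¹) ∧ ScaleTransfer g δ₀ α Λ (fun a => (g.len a ^ 2)⁻¹) ∧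
      ScaleTransfer g δ₀ α Λ (fun a => (g.len a ^ 4)⁻¹) ∧ ScaleTransfer g δ₀ α Λ (fun y => g.len y ^ (-(4 : ℝ))))
    -- real coordinates of `𝔸`, commuting translations, unitary-type background
    (hrepr : ∀ (v : 𝔸) (i : ι), |b.repr v i| ≤ M₂ * ‖v‖) (hT : ∀ (μ ν : κ) (x : S), T μ (T ν x) = T ν (T μ x))
    (hU1 : ∀ m z, ‖((U m z : 𝔸ˣ) : 𝔸)‖ ≤ 1 ∧ ‖(((U m z)⁻¹ : 𝔸ˣ) : 𝔸)‖ ≤ 1)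
    -- (3.35) on the plaquettes through each bond, at that bond's block scale; stencil geometry at range `d₀`
    (h35 : ∀ μ x m n y, Through T μ x m n y → ‖(plaqU T U m n y : 𝔸) - 1‖ ≤ C₀ * ((g.L ^ g.scale (blk x))⁻¹) ^ 2)
    (hd₀B : ∀ μ x, g.dist (blk x) (blk ((T μ).symm x)) ≤ d₀) (hd₀F : ∀ μ x, g.dist (blk x) (blk (T μ x)) ≤ d₀)
    (hd₀FB : ∀ μ ν x, g.dist (blk x) (blk ((T ν).symm (T μ x))) ≤ d₀)
    (hd₀st : ∀ μ x (q : κ × S), q ∈ stBonds T μ x → g.dist (blk x) (blk q.2) ≤ d₀)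
    (hd₀loc : ∀ μ x (q : κ × S), q ∈ B9Eq375Locality.locBondsA' T μ x → g.dist (blk x) (blk q.2) ≤ d₀)
    (hd₀0 : ∀ y : g.Site, g.dist y y ≤ d₀)
    -- the `A`-independent data of the concrete `V′(A)` of (3.60): (3.19) kernels/multipliers and the `a`-weights of (3.24)
    (hw : ∀ y, 0 ≤ w y) (hcard : ∀ y, ((B9Eq360Vprime.block blk y).card : ℝ) * w y ≤ 1)
    (hkQ : ∀ y x, blk x = y → ‖kQ y x‖ ≤ w y) (hsQ : ∀ x, ‖sQ x‖ ≤ 1) (hcfun : ∀ y, |cfun y| ≤ a₀ * (g.len y ^ 2)⁻¹)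
    -- THEOREM 3.1 for `G′(U)`: (3.42)₁,₂,₃ at the rate `δ₀`
    {Gp : Module.End ℝ (S × ι → ℝ)}
    (h342_1 : HasMajorant (g := toB6 g Rr H) (fun p : S × ι => blk p.1) Gp
      (fun a a' => BG * g.len a ^ 2 * Real.exp (-(δ₀ * g.dist a a'))))
    (h342_2 : ∀ k : κ ⊕ κ, HasMajorant (g := toB6 g Rr H) (fun p : S × ι => blk p.1)
      (conj b (diffLetter T U ((g.eta : ℂ)⁻¹) k) * Gp) (fun a a' => BG * g.len a * Real.exp (-(δ₀ * g.dist a a'))))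
    (h342_3 : ∀ k : κ ⊕ κ, HasMajorant (g := toB6 g Rr H) (fun p : S × ι => blk p.1)
      (Gp * conj b (diffLetter T U ((g.eta : ℂ)⁻¹) k)) (fun a a' => BG * g.len a * Real.exp (-(δ₀ * g.dist a a'))))
    -- (3.24): `G′(U) = (Δ′_a(U))⁻¹` for the letter `Δ′_a(U)`
    {Δp : Module.End ℝ (S × ι → ℝ)} (hΔpGp : Δp * Gp = 1) (hGpΔp : Gp * Δp = 1)
    -- the (3.19) letters `Q′(U)`, `Q′*(U)` in their own typing with block-local two-space majorants, a section of the block map (FILE 17)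
    (rep : g.Site → S × ι) (hrep : ∀ y : g.Site, blk (rep y).1 = y)
    {Qc : (S × ι → ℝ) →ₗ[ℝ] (g.Site → ℝ)} {Qcs : (g.Site → ℝ) →ₗ[ℝ] (S × ι → ℝ)} {Linv : Module.End ℝ (g.Site → ℝ)}
    (hQc : HasMajorantHom (g := toB6 g Rr H) (fun p : S × ι => blk p.1) (fun y : g.Site => y) Qc
      (fun a a' : g.Site => κQ * (if a = a' then (1 : ℝ) else 0)))
    (hQcs : HasMajorantHom (g := toB6 g Rr H) (fun y : g.Site => y) (fun p : S × ι => blk p.1) Qcs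
      (fun a a' : g.Site => κQ * (if a = a' then (1 : ℝ) else 0)))
    -- THEOREM 3.2 for `U`: (3.21) `C⁻¹ = (Q′G′²Q′*)⁻¹` exists (`hLinv`) with the KERNEL bound (3.48) at the rate `δ₀`
    (hLinv : (Qc ∘ₗ (Gp * Gp) ∘ₗ Qcs) * Linv = 1)
    (h348 : ∀ y y' : g.Site, |B9Thm34Inv.ker (B9Thm34Inv.vol g d) Linv y y'| ≤
      B₁ * g.len y ^ (-(4 : ℝ)) * g.len y' ^ (-(d : ℝ)) * Real.exp (-(δ₀ * g.dist y y')))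
    -- the (3.15) bond letters `Q(U)`, `Q*(U)` and the weight letter `a` of (3.24)/(3.26), with their majorants
    {G Qs Q a : Module.End ℝ ((κ × S) × ι → ℝ)}
    (hQb : HasMajorant (g := toB6 g Rr H) (fun q : (κ × S) × ι => blk q.1.2) Q (fun a a' => κQb * Real.exp (-(δ₀ * g.dist a a'))))
    (hQsb : HasMajorant (g := toB6 g Rr H) (fun q : (κ × S) × ι => blk q.1.2) Qs (fun a a' => κQb * Real.exp (-(δ₀ * g.dist a a'))))
    (ha324 : HasMajorant (g := toB6 g Rr H) (fun q : (κ × S) × ι => blk q.1.2) a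
      (fun a a' : g.Site => if a = a' then abar * (g.len a ^ 2)⁻¹ else 0))
    -- THEOREM 3.3 for `G(U)`: two-sided inverse of the concrete `Δ_a(U)` and its (3.42)-entries at the rate `δ₀`
    (hΔG : deltaA (conj b (lapDDLetter T ((g.eta : ℂ)⁻¹) U)) (conj b (dPrimeLetter T U g.eta))
      (conjHom b (gradLin T ((g.eta : ℂ)⁻¹) U) ∘ₗ (1 - (Gp ∘ₗ Qcs ∘ₗ Linv ∘ₗ Qc ∘ₗ Gp)) ∘ₗ conjHom b (divLin T ((g.eta : ℂ)⁻¹) U)) Qs a Q * G = 1)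
    (hGΔ : G * deltaA (conj b (lapDDLetter T ((g.eta : ℂ)⁻¹) U)) (conj b (dPrimeLetter T U g.eta))
      (conjHom b (gradLin T ((g.eta : ℂ)⁻¹) U) ∘ₗ (1 - (Gp ∘ₗ Qcs ∘ₗ Linv ∘ₗ Qc ∘ₗ Gp)) ∘ₗ conjHom b (divLin T ((g.eta : ℂ)⁻¹) U)) Qs a Q = 1)
    (hG : HasMajorant (g := toB6 g Rr H) (fun q : (κ × S) × ι => blk q.1.2) G
      (fun a a' => B₀ * g.len a ^ 2 * Real.exp (-(δ₀ * g.dist a a'))))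
    (hDG : ∀ k : κ ⊕ κ, HasMajorant (g := toB6 g Rr H) (fun q : (κ × S) × ι => blk q.1.2)
      (conj b (diffLetter (bT T) (bU U) ((g.eta : ℂ)⁻¹) k) * G) (fun a a' => B₀ * g.len a * Real.exp (-(δ₀ * g.dist a a'))))
    (hGD : ∀ k : κ ⊕ κ, HasMajorant (g := toB6 g Rr H) (fun q : (κ × S) × ι => blk q.1.2)
      (G * conj b (diffLetter (bT T) (bU U) ((g.eta : ℂ)⁻¹) k)) (fun a a' => B₀ * g.len a * Real.exp (-(δ₀ * g.dist a a'))))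
    -- NEW (kernel form): Theorem 3.3's (3.42)₁,₂,₃,₄ for `G(U)` as PRINTED KERNEL BOUNDS (pairing weight `c = η^d`, volume weight `v(y′) = (L^j′ η)^d`)
    {v : g.Site → ℝ} (hv : ∀ y, 0 < v y) {c : ℝ} (hc : 0 < c)
    (hGk : HasKernelBound (g := toB6 g Rr H) (fun q : (κ × S) × ι => blk q.1.2) v c G
      (fun a a' => B₀ * g.len a ^ 2 * Real.exp (-(δ₀ * g.dist a a'))))
    (hDGk : ∀ k : κ ⊕ κ, HasKernelBound (g := toB6 g Rr H) (fun q : (κ × S) × ι => blk q.1.2) v c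
      (conj b (diffLetter (bT T) (bU U) ((g.eta : ℂ)⁻¹) k) * G) (fun a a' => B₀ * g.len a * Real.exp (-(δ₀ * g.dist a a'))))
    (hGDk : ∀ l : κ ⊕ κ, HasKernelBound (g := toB6 g Rr H) (fun q : (κ × S) × ι => blk q.1.2) v c
      (G * conj b (diffLetter (bT T) (bU U) ((g.eta : ℂ)⁻¹) l)) (fun a a' => B₀ * g.len a * Real.exp (-(δ₀ * g.dist a a'))))
    (hDGDk : ∀ k l : κ ⊕ κ, HasKernelBound (g := toB6 g Rr H) (fun q : (κ × S) × ι => blk q.1.2) v c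
      (conj b (diffLetter (bT T) (bU U) ((g.eta : ℂ)⁻¹) k) * G * conj b (diffLetter (bT T) (bU U) ((g.eta : ℂ)⁻¹) l)) (fun a a' => B₀ * Real.exp (-(δ₀ * g.dist a a')))) :
    ∃ a₁ : ℝ, 0 < a₁ ∧ ∃ B : ℝ, 0 ≤ B ∧
    ∀ (α₁ : ℝ), 0 ≤ α₁ → α₁ ≤ a₁ →
    -- the exponent field `A` in the domain (3.37), read blockwise in the shapes of FILES 1–19, and the `A`-dependent (3.59) data `kF`, `sF`
    ∀ (A : κ → S → 𝔸) (kF : g.Site → S → 𝔸 →L[ℝ] 𝔸) (sF : S → 𝔸 →L[ℝ] 𝔸),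
      (∀ y x, blk x = y → ‖kF y x‖ ≤ Cq * α₁ * w y) → (∀ x, ‖sF x‖ ≤ Cq * α₁) →
      (∀ ν k x, ‖((g.eta : ℂ)⁻¹) • covDstar T U ν (A k) x‖ ≤ α₁ * (g.len (blk x) ^ 2)⁻¹) →
      (∀ μ ν x, ‖((g.eta : ℂ)⁻¹) • covD T U μ (A ν) x‖ ≤ α₁ * (g.len (blk x) ^ 2)⁻¹) →
      (∀ μ ν x, ‖((g.eta : ℂ)⁻¹) • covDstar T U ν (A ν) (T μ x)‖ ≤ α₁ * (g.len (blk x) ^ 2)⁻¹) →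
      (∀ μ x, ‖((g.eta : ℂ)⁻¹) • covDstar T U μ (tauB T U μ (A μ)) x‖ ≤ α₁ * (g.len (blk x) ^ 2)⁻¹) →
      (∀ μ ν k x, ‖((g.eta : ℂ)⁻¹) • covD T U μ (A k) ((T ν).symm x)‖ ≤ α₁ * (g.len (blk x) ^ 2)⁻¹) →
      (∀ k x, ‖A k x‖ ≤ α₁ * (g.len (blk x))⁻¹) → (∀ ν k x, ‖tauB T U ν (A k) x‖ ≤ α₁ * (g.len (blk x))⁻¹) →
      (∀ μ k x, ‖tauF T U μ (A k) x‖ ≤ α₁ * (g.len (blk x))⁻¹) →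
      (∀ k μ ν x, ‖A k ((T ν).symm (T μ x))‖ ≤ α₁ * (g.len (blk x))⁻¹) →
      (∀ μ x m z, (m, z) ∈ stBonds T μ x → ‖A m z‖ ≤ α₁ * (g.len (blk x))⁻¹) →
      (∀ μ x m z, (m, z) ∈ B9Eq375Locality.locBondsA T μ x → ‖A m z‖ ≤ α₁ * (g.len (blk x))⁻¹) →
      (∀ μ x m n y, Through T μ x m n y →
        ‖covD T U m (A n) y‖ ≤ g.eta * (α₁ * ((g.len (blk x))⁻¹) ^ 2) ∧ ‖covD T U n (A m) y‖ ≤ g.eta * (α₁ * ((g.len (blk x))⁻¹) ^ 2)) →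
    -- the (3.57)/(3.59) letters `F′₂(A)`, `F′₂*(A)` (block-local, size `c_F α₁`)
    ∀ {Qc' Fc : (S × ι → ℝ) →ₗ[ℝ] (g.Site → ℝ)} {Qcs' Fcs : (g.Site → ℝ) →ₗ[ℝ] (S × ι → ℝ)},
      Qc' = Qc + Fc → Qcs' = Qcs + Fcs →
      HasMajorantHom (g := toB6 g Rr H) (fun p : S × ι => blk p.1) (fun y : g.Site => y) Fc
        (fun a a' : g.Site => cF * α₁ * (if a = a' then (1 : ℝ) else 0)) →
      HasMajorantHom (g := toB6 g Rr H) (fun y : g.Site => y) (fun p : S × ι => blk p.1) Fcs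
        (fun a a' : g.Site => cF * α₁ * (if a = a' then (1 : ℝ) else 0)) →
    -- the (3.80)–(3.81) letters `F₂(A)`, `F₂*(A)` («|F₂(A)|, |F₂*(A)| ≦ O(1)α₁»), `P₂(A)` of (3.82)
    ∀ {P₂ Qs' Q' F₂ F₂s : Module.End ℝ ((κ × S) × ι → ℝ)},
      Q' = Q + F₂ → Qs' = Qs + F₂s → P₂ = pTwo Qs Q F₂ F₂s a →
      HasMajorant (g := toB6 g Rr H) (fun q : (κ × S) × ι => blk q.1.2) F₂ (fun a a' => cFb * α₁ * Real.exp (-(δ₀ * g.dist a a'))) →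
      HasMajorant (g := toB6 g Rr H) (fun q : (κ × S) × ι => blk q.1.2) F₂s (fun a a' => cFb * α₁ * Real.exp (-(δ₀ * g.dist a a'))) →
      -- (i) THEOREM 3.4 FOR `G′(U′U) := G′(U)(I − V′(A)G′(U))⁻¹` ((3.64))
      (Δp - conj b (vPrimeConc T U g.eta A blk kQ kF sQ sF cfun)) * (gPrimeExtEnd Gp (conj b (vPrimeConc T U g.eta A blk kQ kF sQ sF cfun) * Gp)) = 1 ∧
      (gPrimeExtEnd Gp (conj b (vPrimeConc T U g.eta A blk kQ kF sQ sF cfun) * Gp)) * (Δp - conj b (vPrimeConc T U g.eta A blk kQ kF sQ sF cfun)) = 1 ∧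
      (∀ (X : Module.End ℝ (S × ι → ℝ)) (P : g.Site → ℝ), (∀ y, 0 ≤ P y) →
        HasMajorant (g := toB6 g Rr H) (fun p : S × ι => blk p.1) (X * Gp) (fun a a' => BG * P a * Real.exp (-(δ₀ * g.dist a a'))) →
        HasMajorant (g := toB6 g Rr H) (fun p : S × ι => blk p.1) (X * (gPrimeExtEnd Gp (conj b (vPrimeConc T U g.eta A blk kQ kF sQ sF cfun) * Gp)))
          (fun a a' => B * P a * Real.exp (-(9 / 10 * δ₀ * g.dist a a')))) ∧
      (∀ Y : Module.End ℝ (S × ι → ℝ),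
        HasMajorant (g := toB6 g Rr H) (fun p : S × ι => blk p.1) (Gp * Y) (fun a a' => BG * g.len a * Real.exp (-(δ₀ * g.dist a a'))) →
        HasMajorant (g := toB6 g Rr H) (fun p : S × ι => blk p.1) ((gPrimeExtEnd Gp (conj b (vPrimeConc T U g.eta A blk kQ kF sQ sF cfun) * Gp)) * Y)
          (fun a a' => B * g.len a * Real.exp (-(9 / 10 * δ₀ * g.dist a a')))) ∧
    ∃ (Tinv : Module.End ℝ (g.Site → ℝ)) (GExt : Module.End ℝ ((κ × S) × ι → ℝ)),
      -- (ii) THEOREM 3.4 FOR `(Q′G′²Q′*)⁻¹(U′U)`: two-sided inverse with the printed kernel bound (3.48)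
      Tinv * (Qc' ∘ₗ ((gPrimeExtEnd Gp (conj b (vPrimeConc T U g.eta A blk kQ kF sQ sF cfun) * Gp)) * (gPrimeExtEnd Gp (conj b (vPrimeConc T U g.eta A blk kQ kF sQ sF cfun) * Gp))) ∘ₗ Qcs') = 1 ∧
      (Qc' ∘ₗ ((gPrimeExtEnd Gp (conj b (vPrimeConc T U g.eta A blk kQ kF sQ sF cfun) * Gp)) * (gPrimeExtEnd Gp (conj b (vPrimeConc T U g.eta A blk kQ kF sQ sF cfun) * Gp))) ∘ₗ Qcs') * Tinv = 1 ∧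
      (∀ y y' : g.Site, |B9Thm34Inv.ker (B9Thm34Inv.vol g d) Tinv y y'| ≤
        B * g.len y ^ (-(4 : ℝ)) * g.len y' ^ (-(d : ℝ)) * Real.exp (-(9 / 25 * δ₀ * g.dist y y'))) ∧
      -- (ii′) THEOREM 3.4 FOR `R(U′U)`: (3.68) for `P′(A)` and (3.49) for `P(U′U) = I − R(U′U)` built with THIS `C⁻¹(U′U)` (FILE 27)
      HasMajorant (g := toB6 g Rr H) (fun p : S × ι => blk p.1) (B9Eq360Vprime.pPrime Gp (gPrimeExtEnd Gp (conj b (vPrimeConc T U g.eta A blk kQ kF sQ sF cfun) * Gp)) (Qcs ∘ₗ secRes rep) (Qcs' ∘ₗ secRes rep) (secConj rep Linv) (secConj rep Tinv) (secExt rep ∘ₗ Qc) (secExt rep ∘ₗ Qc'))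
        (fun a a' => B * α₁ * Real.exp (-(1 / 4 * δ₀ * g.dist a a'))) ∧
      HasMajorantHom (g := toB6 g Rr H) (fun p : S × ι => blk p.1) (fun q : (κ × S) × ι => blk q.1.2)
        (conjHom b (gradLin T ((g.eta : ℂ)⁻¹) U) ∘ₗ (B9Eq360Vprime.pPrime Gp (gPrimeExtEnd Gp (conj b (vPrimeConc T U g.eta A blk kQ kF sQ sF cfun) * Gp)) (Qcs ∘ₗ secRes rep) (Qcs' ∘ₗ secRes rep) (secConj rep Linv) (secConj rep Tinv) (secExt rep ∘ₗ Qc) (secExt rep ∘ₗ Qc')))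
        (fun a a' => B * α₁ * (g.len a)⁻¹ * Real.exp (-(1 / 4 * δ₀ * g.dist a a'))) ∧
      HasMajorantHom (g := toB6 g Rr H) (fun q : (κ × S) × ι => blk q.1.2) (fun p : S × ι => blk p.1)
        ((B9Eq360Vprime.pPrime Gp (gPrimeExtEnd Gp (conj b (vPrimeConc T U g.eta A blk kQ kF sQ sF cfun) * Gp)) (Qcs ∘ₗ secRes rep) (Qcs' ∘ₗ secRes rep) (secConj rep Linv) (secConj rep Tinv) (secExt rep ∘ₗ Qc) (secExt rep ∘ₗ Qc')) ∘ₗ conjHom b (divLin T ((g.eta : ℂ)⁻¹) U))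
        (fun a a' => B * α₁ * (g.len a)⁻¹ * Real.exp (-(1 / 4 * δ₀ * g.dist a a'))) ∧
      HasMajorant (g := toB6 g Rr H) (fun q : (κ × S) × ι => blk q.1.2)
        (conjHom b (gradLin T ((g.eta : ℂ)⁻¹) U) ∘ₗ (B9Eq360Vprime.pPrime Gp (gPrimeExtEnd Gp (conj b (vPrimeConc T U g.eta A blk kQ kF sQ sF cfun) * Gp)) (Qcs ∘ₗ secRes rep) (Qcs' ∘ₗ secRes rep) (secConj rep Linv) (secConj rep Tinv) (secExt rep ∘ₗ Qc) (secExt rep ∘ₗ Qc')) ∘ₗ conjHom b (divLin T ((g.eta : ℂ)⁻¹) U))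
        (fun a a' => B * α₁ * (g.len a ^ 2)⁻¹ * Real.exp (-(1 / 4 * δ₀ * g.dist a a'))) ∧
      HasMajorant (g := toB6 g Rr H) (fun p : S × ι => blk p.1) (B9Eq360Vprime.pOp (gPrimeExtEnd Gp (conj b (vPrimeConc T U g.eta A blk kQ kF sQ sF cfun) * Gp)) (Qcs' ∘ₗ secRes rep) (secConj rep Tinv) (secExt rep ∘ₗ Qc'))
        (fun a a' => B * Real.exp (-(1 / 4 * δ₀ * g.dist a a'))) ∧
      HasMajorantHom (g := toB6 g Rr H) (fun p : S × ι => blk p.1) (fun q : (κ × S) × ι => blk q.1.2)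
        (conjHom b (gradLin T ((g.eta : ℂ)⁻¹) U) ∘ₗ (B9Eq360Vprime.pOp (gPrimeExtEnd Gp (conj b (vPrimeConc T U g.eta A blk kQ kF sQ sF cfun) * Gp)) (Qcs' ∘ₗ secRes rep) (secConj rep Tinv) (secExt rep ∘ₗ Qc')))
        (fun a a' => B * (g.len a)⁻¹ * Real.exp (-(1 / 4 * δ₀ * g.dist a a'))) ∧
      HasMajorantHom (g := toB6 g Rr H) (fun q : (κ × S) × ι => blk q.1.2) (fun p : S × ι => blk p.1)
        ((B9Eq360Vprime.pOp (gPrimeExtEnd Gp (conj b (vPrimeConc T U g.eta A blk kQ kF sQ sF cfun) * Gp)) (Qcs' ∘ₗ secRes rep) (secConj rep Tinv) (secExt rep ∘ₗ Qc')) ∘ₗ conjHom b (divLin T ((g.eta : ℂ)⁻¹) U))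
        (fun a a' => B * (g.len a)⁻¹ * Real.exp (-(1 / 4 * δ₀ * g.dist a a'))) ∧
      HasMajorant (g := toB6 g Rr H) (fun q : (κ × S) × ι => blk q.1.2)
        (conjHom b (gradLin T ((g.eta : ℂ)⁻¹) U) ∘ₗ (B9Eq360Vprime.pOp (gPrimeExtEnd Gp (conj b (vPrimeConc T U g.eta A blk kQ kF sQ sF cfun) * Gp)) (Qcs' ∘ₗ secRes rep) (secConj rep Tinv) (secExt rep ∘ₗ Qc')) ∘ₗ conjHom b (divLin T ((g.eta : ℂ)⁻¹) U))
        (fun a a' => B * (g.len a ^ 2)⁻¹ * Real.exp (-(1 / 4 * δ₀ * g.dist a a'))) ∧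
      -- (iii) THEOREM 3.4 FOR `G(U′U)`: two-sided inverse of the concrete `Δ_a(U′U)`, every (3.42)-entry in block-majorant and kernel form
      deltaA (conj b (lapDDLetter T ((g.eta : ℂ)⁻¹) (prodCfg U g.eta A)))
          (conj b (dPrimeLetter T (prodCfg U g.eta A) g.eta))
          (conjHom b (gradLin T ((g.eta : ℂ)⁻¹) (prodCfg U g.eta A)) ∘ₗ (1 - ((Gp ∘ₗ Qcs ∘ₗ Linv ∘ₗ Qc ∘ₗ Gp) + (B9Eq360Vprime.pPrime Gp (gPrimeExtEnd Gp (conj b (vPrimeConc T U g.eta A blk kQ kF sQ sF cfun) * Gp)) (Qcs ∘ₗ secRes rep) (Qcs' ∘ₗ secRes rep) (secConj rep Linv) (secConj rep Tinv) (secExt rep ∘ₗ Qc) (secExt rep ∘ₗ Qc'))))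
            ∘ₗ conjHom b (divLin T ((g.eta : ℂ)⁻¹) (prodCfg U g.eta A))) Qs' a Q' * GExt = 1 ∧
      GExt *
      deltaA (conj b (lapDDLetter T ((g.eta : ℂ)⁻¹) (prodCfg U g.eta A)))
          (conj b (dPrimeLetter T (prodCfg U g.eta A) g.eta))
          (conjHom b (gradLin T ((g.eta : ℂ)⁻¹) (prodCfg U g.eta A)) ∘ₗ (1 - ((Gp ∘ₗ Qcs ∘ₗ Linv ∘ₗ Qc ∘ₗ Gp) + (B9Eq360Vprime.pPrime Gp (gPrimeExtEnd Gp (conj b (vPrimeConc T U g.eta A blk kQ kF sQ sF cfun) * Gp)) (Qcs ∘ₗ secRes rep) (Qcs' ∘ₗ secRes rep) (secConj rep Linv) (secConj rep Tinv) (secExt rep ∘ₗ Qc) (secExt rep ∘ₗ Qc'))))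
            ∘ₗ conjHom b (divLin T ((g.eta : ℂ)⁻¹) (prodCfg U g.eta A))) Qs' a Q' = 1 ∧
      (∀ (X : Module.End ℝ ((κ × S) × ι → ℝ)) (P : g.Site → ℝ), (∀ y, 0 ≤ P y) →
        HasMajorant (g := toB6 g Rr H) (fun q : (κ × S) × ι => blk q.1.2) (X * G)
          (fun a a' => B₀ * P a * Real.exp (-(δ₀ * g.dist a a'))) →
        HasMajorant (g := toB6 g Rr H) (fun q : (κ × S) × ι => blk q.1.2) (X * GExt)
          (fun a a' => B * P a * Real.exp (-(δ₀ / 6 * g.dist a a')))) ∧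
      (∀ Y : Module.End ℝ ((κ × S) × ι → ℝ),
        HasMajorant (g := toB6 g Rr H) (fun q : (κ × S) × ι => blk q.1.2) (G * Y)
          (fun a a' => B₀ * g.len a * Real.exp (-(δ₀ * g.dist a a'))) →
        HasMajorant (g := toB6 g Rr H) (fun q : (κ × S) × ι => blk q.1.2) (GExt * Y)
          (fun a a' => B * g.len a * Real.exp (-(δ₀ / 6 * g.dist a a')))) ∧
      -- all four entries of (3.42) for `G(U′U)` in the printed kernel form
      HasKernelBound (g := toB6 g Rr H) (fun q : (κ × S) × ι => blk q.1.2) v c GExt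
        (fun a a' => B * g.len a ^ 2 * Real.exp (-(1 / 10 * δ₀ * g.dist a a'))) ∧
      (∀ k : κ ⊕ κ, HasKernelBound (g := toB6 g Rr H) (fun q : (κ × S) × ι => blk q.1.2) v c
        (conj b (diffLetter (bT T) (bU U) ((g.eta : ℂ)⁻¹) k) * GExt)
        (fun a a' => B * g.len a * Real.exp (-(1 / 10 * δ₀ * g.dist a a')))) ∧
      (∀ l : κ ⊕ κ, HasKernelBound (g := toB6 g Rr H) (fun q : (κ × S) × ι => blk q.1.2) v c
        (GExt * conj b (diffLetter (bT T) (bU U) ((g.eta : ℂ)⁻¹) l))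
        (fun a a' => B * g.len a * Real.exp (-(1 / 10 * δ₀ * g.dist a a')))) ∧
      (∀ k l : κ ⊕ κ, HasKernelBound (g := toB6 g Rr H) (fun q : (κ × S) × ι => blk q.1.2) v c
        (conj b (diffLetter (bT T) (bU U) ((g.eta : ℂ)⁻¹) k) * GExt * conj b (diffLetter (bT T) (bU U) ((g.eta : ℂ)⁻¹) l))
        (fun a a' => B * Real.exp (-(1 / 10 * δ₀ * g.dist a a')))) := by
  classical
  obtain ⟨a₁, ha₁, B₁', hB₁', HA⟩ := thm34_Gp_final (Rr := Rr) (H := H) b T U blk d δ₀ BG Cq a₀ d₀ M₂ kQ sQ cfun w hBG hCq ha₀ hM₂ hδ₀ hdnn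
    htri hrefl hsym hlen hlenη hη h261 hST hrepr hU1 hd₀B hd₀F hd₀0 hw hcard hkQ hsQ hcfun hΔpGp hGpΔp h342_1 h342_2 h342_3
  obtain ⟨a₂, ha₂, HB⟩ := thm34_Cinv_final (Rr := Rr) (H := H) b T U blk d δ₀ κQ BG B₁ cF Cq a₀ d₀ M₂ kQ sQ cfun w hκQ hBG hB₁ hcF hCq ha₀
    hM₂ hδ₀ hdnn htri hrefl hsym hlen hlenη hη h261 hST hrepr hU1 hd₀B hd₀F hd₀0 hw hcard hkQ hsQ hcfun h342_1 h342_2 hQc hQcs hLinv h348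
  obtain ⟨a₃, ha₃, B₃, hB₃, HC⟩ := thm34_G_kernel_final (Rr := Rr) (H := H) b T U blk d δ₀ B₀ κQ BG B₁ cF Cq a₀ C₀ d₀ M₂ κQb cFb abar kQ sQ
    cfun w hB₀ hκQ hBG hB₁ hcF hCq ha₀ hC₀ hM₂ hδ₀ hκQb hcFb habar hdnn htri hrefl hsym hlen hlenη hη hL h261 hST hrepr hT hU1 h35 hd₀B hd₀F
    hd₀FB hd₀st hd₀loc hd₀0 hw hcard hkQ hsQ hcfun h342_1 h342_2 h342_3 rep hrep hQc hQcs hLinv h348 hQb hQsb ha324 hΔG hGΔ hG hDG hGD hv hc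
    hGk hDGk hGDk hDGDk
  obtain ⟨a₄, ha₄, K₄, hK₄, HD⟩ := thm34_R_final (Rr := Rr) (H := H) b T U blk d δ₀ κQ BG B₁ cF Cq a₀ d₀ M₂ kQ sQ cfun w hκQ hBG hB₁ hcF
    hCq ha₀ hM₂ hδ₀ hdnn htri hrefl hsym hlen hlenη hη h261 hST hrepr hU1 hd₀B hd₀F hd₀0 hw hcard hkQ hsQ hcfun h342_1 h342_2 h342_3 rep
    hrep hQc hQcs hLinv h348
  have hcK : 0 ≤ 2 * B₁ * B6.c1 d (2 / 5 * δ₀) (1 / 10) :=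
    mul_nonneg (mul_nonneg zero_le_two hB₁.le) (B6RandomWalk.c1_nonneg d (2 / 5 * δ₀) (1 / 10))
  refine ⟨min (min (min a₁ a₂) a₃) a₄, lt_min (lt_min (lt_min ha₁ ha₂) ha₃) ha₄, B₁' + 2 * B₁ * B6.c1 d (2 / 5 * δ₀) (1 / 10) + B₃ + K₄,
    add_nonneg (add_nonneg (add_nonneg hB₁' hcK) hB₃) hK₄, ?_⟩
  intro α₁ hα₁0 hα₁1 A kF sF hkF hsF h337B h337F h337B' h337Bτ h337FB hA hAτB hAτF hAFB hAst hAloc hdAst Qc' Fc Qcs' Fcs h357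
    h357s hFc hFcs P₂ Qs' Q' F₂ F₂s h380 h380s hP₂def hF₂ hF₂s
  have hα₁a : α₁ ≤ a₁ := hα₁1.trans ((min_le_left _ _).trans ((min_le_left _ _).trans (min_le_left _ _)))
  have hα₁b : α₁ ≤ a₂ := hα₁1.trans ((min_le_left _ _).trans ((min_le_left _ _).trans (min_le_right _ _)))
  have hα₁c : α₁ ≤ a₃ := hα₁1.trans ((min_le_left _ _).trans (min_le_right _ _))
  have hα₁d : α₁ ≤ a₄ := hα₁1.trans (min_le_right _ _)
  obtain ⟨i1, i2, hGpL, hGpR⟩ := HA α₁ hα₁0 hα₁a A kF sF hkF hsF h337B h337F h337Bτ hA hAτB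
  obtain ⟨Tinv₂, f1, -, hTk⟩ := HB α₁ hα₁0 hα₁b A kF sF hkF hsF h337B hA hAτB h357 h357s hFc hFcs
  obtain ⟨Tinv, GExt, e1, e2, e3, e4, hLeft, hRight, k1, k2, k3, k4⟩ := HC α₁ hα₁0 hα₁c A kF sF hkF hsF h337B h337F h337B' h337Bτ
    h337FB hA hAτB hAτF hAFB hAst hAloc hdAst h357 h357s hFc hFcs h380 h380s hP₂def hF₂ hF₂s
  obtain ⟨Tinv₃, g1, -, r1, r2, r3, r4, r5, r6, r7, r8⟩ := HD α₁ hα₁0 hα₁d A kF sF hkF hsF h337B h337F h337Bτ hA hAτB h357 h357s hFc hFcs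
  -- the three `C⁻¹(U′U)` agree (uniqueness of the two-sided inverse)
  have hTT : Tinv₂ = Tinv := left_inv_eq_right_inv f1 e2
  rw [hTT] at hTk
  have hT3 : Tinv₃ = Tinv := left_inv_eq_right_inv g1 e2
  rw [hT3] at r1 r2 r3 r4 r5 r6 r7 r8
  -- one constant `B`
  have hle1 : B₁' ≤ B₁' + 2 * B₁ * B6.c1 d (2 / 5 * δ₀) (1 / 10) + B₃ + K₄ := by linarith only [hcK, hB₃, hK₄]
  have hle2 : 2 * B₁ * B6.c1 d (2 / 5 * δ₀) (1 / 10) ≤ B₁' + 2 * B₁ * B6.c1 d (2 / 5 * δ₀) (1 / 10) + B₃ + K₄ := by linarith only [hB₁', hB₃, hK₄]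
  have hle3 : B₃ ≤ B₁' + 2 * B₁ * B6.c1 d (2 / 5 * δ₀) (1 / 10) + B₃ + K₄ := by linarith only [hB₁', hcK, hK₄]
  have hle4 : K₄ ≤ B₁' + 2 * B₁ * B6.c1 d (2 / 5 * δ₀) (1 / 10) + B₃ + K₄ := by linarith only [hB₁', hcK, hB₃]
  have hle4' : K₄ * α₁ ≤ (B₁' + 2 * B₁ * B6.c1 d (2 / 5 * δ₀) (1 / 10) + B₃ + K₄) * α₁ := mul_le_mul_of_nonneg_right hle4 hα₁0
  have hw1i : ∀ a : g.Site, 0 ≤ (g.len a)⁻¹ := fun a => inv_nonneg.mpr (hlen a).le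
  have hw1 : ∀ a : g.Site, 0 ≤ g.len a := fun a => (hlen a).le
  have hw2 : ∀ a : g.Site, 0 ≤ g.len a ^ 2 := fun a => sq_nonneg _
  refine ⟨i1, i2, fun X P hP0 hX => ?_, fun Y hY => ?_, Tinv, GExt, e1, e2, fun y y' => ?_, ?_, ?_, ?_, ?_, ?_, ?_, ?_, ?_, e3, e4,
    fun X P hP0 hXG => ?_, fun Y hGY => ?_, ?_, fun k => ?_, fun l => ?_, fun k l => ?_⟩
  · exact hasMajorant_mono (g := toB6 g Rr H) _ (hGpL X P hP0 hX) fun a a' =>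
      mul_le_mul_of_nonneg_right (mul_le_mul_of_nonneg_right hle1 (hP0 a)) (Real.exp_nonneg _)
  · exact hasMajorant_mono (g := toB6 g Rr H) _ (hGpR Y hY) fun a a' =>
      mul_le_mul_of_nonneg_right (mul_le_mul_of_nonneg_right hle1 (hw1 a)) (Real.exp_nonneg _)
  · exact (hTk y y').trans (mul_le_mul_of_nonneg_right (mul_le_mul_of_nonneg_right (mul_le_mul_of_nonneg_right hle2
      (Real.rpow_nonneg (hlen y).le _)) (Real.rpow_nonneg (hlen y').le _)) (Real.exp_nonneg _))
  · exact hasMajorant_mono (g := toB6 g Rr H) _ r1 fun a a' => mul_le_mul_of_nonneg_right hle4' (Real.exp_nonneg _)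
  · exact hasMajorantHom_mono (g := toB6 g Rr H) _ _ r2 fun a a' =>
      mul_le_mul_of_nonneg_right (mul_le_mul_of_nonneg_right hle4' (hw1i a)) (Real.exp_nonneg _)
  · exact hasMajorantHom_mono (g := toB6 g Rr H) _ _ r3 fun a a' =>
      mul_le_mul_of_nonneg_right (mul_le_mul_of_nonneg_right hle4' (hw1i a)) (Real.exp_nonneg _)
  · exact hasMajorant_mono (g := toB6 g Rr H) _ r4 fun a a' =>
      mul_le_mul_of_nonneg_right (mul_le_mul_of_nonneg_right hle4' (inv_nonneg.mpr (sq_nonneg _))) (Real.exp_nonneg _)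
  · exact hasMajorant_mono (g := toB6 g Rr H) _ r5 fun a a' => mul_le_mul_of_nonneg_right hle4 (Real.exp_nonneg _)
  · exact hasMajorantHom_mono (g := toB6 g Rr H) _ _ r6 fun a a' =>
      mul_le_mul_of_nonneg_right (mul_le_mul_of_nonneg_right hle4 (hw1i a)) (Real.exp_nonneg _)
  · exact hasMajorantHom_mono (g := toB6 g Rr H) _ _ r7 fun a a' =>
      mul_le_mul_of_nonneg_right (mul_le_mul_of_nonneg_right hle4 (hw1i a)) (Real.exp_nonneg _)
  · exact hasMajorant_mono (g := toB6 g Rr H) _ r8 fun a a' =>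
      mul_le_mul_of_nonneg_right (mul_le_mul_of_nonneg_right hle4 (inv_nonneg.mpr (sq_nonneg _))) (Real.exp_nonneg _)
  · exact hasMajorant_mono (g := toB6 g Rr H) _ (hLeft X P hP0 hXG) fun a a' =>
      mul_le_mul_of_nonneg_right (mul_le_mul_of_nonneg_right hle3 (hP0 a)) (Real.exp_nonneg _)
  · exact hasMajorant_mono (g := toB6 g Rr H) _ (hRight Y hGY) fun a a' =>
      mul_le_mul_of_nonneg_right (mul_le_mul_of_nonneg_right hle3 (hw1 a)) (Real.exp_nonneg _)
  · exact hasKernelBound_mono (g := toB6 g Rr H) _ hv k1 fun a a' =>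
      mul_le_mul_of_nonneg_right (mul_le_mul_of_nonneg_right hle3 (hw2 a)) (Real.exp_nonneg _)
  · exact hasKernelBound_mono (g := toB6 g Rr H) _ hv (k2 k) fun a a' =>
      mul_le_mul_of_nonneg_right (mul_le_mul_of_nonneg_right hle3 (hw1 a)) (Real.exp_nonneg _)
  · exact hasKernelBound_mono (g := toB6 g Rr H) _ hv (k3 l) fun a a' =>
      mul_le_mul_of_nonneg_right (mul_le_mul_of_nonneg_right hle3 (hw1 a)) (Real.exp_nonneg _)
  · exact hasKernelBound_mono (g := toB6 g Rr H) _ hv (k4 k l) fun a a' =>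
      mul_le_mul_of_nonneg_right hle3 (Real.exp_nonneg _)
end All

end Literature.MathematicalPhysics.QuantumFieldTheory.Balaban1983to89.B9Thm34AllFinal
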